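import Summits.CriticalPhenomena.PercolationContinuityZ3.Theorems.PercNearOneGluingAdditiveGluingExploreBFSDefs
import Literature.Probability.Percolation.PercolationEvents
import HarnessLib

/-! # Crux `PercNearOneGluing.AdditiveGluing` (stmt-CriticalPhenomena-4576) — the BFS observer exploration: structural properties

Support file (`--supports stmt-CriticalPhenomena-4576`, cell `prim-png-dp-al5` gen 7; memo `EXPLORE-g7.md` §1–§3).  No `sorry`, no definitions
(the objects `ExploreBFS.layer / blob / contacts / leafEvent / LeafIdx` live in `…ExploreBFSDefs.lean`).

* locality: `layer_eq_of_agree`, `blob_eq_of_agree`, `contacts_eq_of_agree`, `determinedBy_leaf` — the leaf event `{blob = U, contacts = B}`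
  is determined by the pairs meeting `U`;
* `star_of_leaf`, `join_of_leaf` (STAR/JOIN of `BlobTransfer`), `not_reachable_of_contacts_free` / `dead_leaf` (a leaf whose contact set misses
  `A ∪ {b}` has `o ↮ A`), `exists_leaf` / `disjoint_leaf` (the leaves partition);
The companion `…ExploreBFSReduction.lean` assembles these into the leaf system and proves Theorem A (`ExploreBFS.preFKG_of_hereditary`)
and (SAU) ⇒ AdditiveGluing (`ExploreBFS.additiveGluing_of_SAU`).
[cite: KozmaNitzan2024, Lemma 5 (p. 13), Theorem 4 (pp. 12–14), Question 7 (p. 36)]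
-/

noncomputable section

namespace Summit.CriticalPhenomena.PercolationContinuityZ3.Theorems

open MeasureTheory Set
open Literature.Probability.Percolation
open scoped BigOperators
open Classical

namespace ExploreBFS

variable {V : Type*}

/-! ### Elementary properties of the layers -/

/-- `layer 0 = {o}`. [this work] -/
@[simp] theorem layer_zero (N : Set V) (o : V) (ω : BondConfig V) : layer N o ω 0 = {o} := rfl

/-- The recursion step. [this work] -/
theorem layer_succ (N : Set V) (o : V) (ω : BondConfig V) (t : ℕ) :
    layer N o ω (t + 1) = layer N o ω t ∪ {v | ∃ u ∈ layer N o ω t, u ∉ N ∧ u ≠ v ∧ s(u, v) ∈ ω} := rfl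

/-- Layers increase. [this work] -/
theorem layer_subset_succ (N : Set V) (o : V) (ω : BondConfig V) (t : ℕ) :
    layer N o ω t ⊆ layer N o ω (t + 1) := fun _ hv => Or.inl hv

/-- Layers are monotone in the round. [this work] -/
theorem layer_mono (N : Set V) (o : V) (ω : BondConfig V) {s t : ℕ} (hst : s ≤ t) :
    layer N o ω s ⊆ layer N o ω t := by
  induction hst with
  | refl => exact Subset.rfl
  | step _ ih => exact ih.trans (layer_subset_succ N o ω _)

/-- `o` lies in every layer. [this work] -/
theorem mem_layer_self (N : Set V) (o : V) (ω : BondConfig V) (t : ℕ) : o ∈ layer N o ω t :=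
  layer_mono N o ω (Nat.zero_le t) rfl

/-- Every vertex of a layer is joined to `o` by an open path. [this work] -/
theorem reachable_of_mem_layer (N : Set V) (o : V) (ω : BondConfig V) :
    ∀ (t : ℕ) {v : V}, v ∈ layer N o ω t → (openGraph ω).Reachable o v := by
  intro t
  induction t with
  | zero => intro v hv; rw [layer_zero] at hv; rw [mem_singleton_iff.1 hv]
  | succ t ih =>
    intro v hv
    rcases hv with hv | ⟨u, hu, _, hne, huv⟩
    · exact ih hv
    · exact (ih hu).trans ((openGraph_adj ω u v).2 ⟨huv, hne⟩).reachable

/-- Contact-freeness is inherited by earlier rounds. [this work] -/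
theorem contactFree_mono {N : Set V} {o : V} {ω : BondConfig V} {s t : ℕ} (hst : s ≤ t)
    (h : ContactFree N o ω t) : ContactFree N o ω s :=
  fun r hr v hv => h r (hr.trans hst) v hv

/-- Contact-freeness at `t + 1` is contact-freeness at `t` plus a clean new layer. [this work] -/
theorem contactFree_succ_iff (N : Set V) (o : V) (ω : BondConfig V) (t : ℕ) :
    ContactFree N o ω (t + 1) ↔ ContactFree N o ω t ∧ ∀ v ∈ layer N o ω (t + 1), v ∉ N := by
  constructor
  · exact fun h => ⟨contactFree_mono (Nat.le_succ t) h, h (t + 1) le_rfl⟩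
  · rintro ⟨h1, h2⟩ s hs v hv
    rcases Nat.lt_or_ge s (t + 1) with hlt | hge
    · exact h1 s (Nat.lt_succ_iff.1 hlt) v hv
    · have : s = t + 1 := le_antisymm hs hge
      subst this; exact h2 v hv

/-- The blob avoids the forbidden set. [this work] -/
theorem blob_subset_compl (N : Set V) (o : V) (ω : BondConfig V) : blob N o ω ⊆ Nᶜ :=
  fun v ⟨t, hcf, hv⟩ hvN => hcf t le_rfl v hv hvN

/-- A contact-free layer lies in the blob. [this work] -/
theorem layer_subset_blob {N : Set V} {o : V} {ω : BondConfig V} {t : ℕ} (h : ContactFree N o ω t) :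
    layer N o ω t ⊆ blob N o ω := fun _ hv => ⟨t, h, hv⟩

/-- Every blob vertex is joined to `o`. [this work] -/
theorem reachable_of_mem_blob {N : Set V} {o : V} {ω : BondConfig V} {v : V} (hv : v ∈ blob N o ω) :
    (openGraph ω).Reachable o v := by
  obtain ⟨t, _, hv⟩ := hv
  exact reachable_of_mem_layer N o ω t hv

/-! ### The leaf events are determined by the pairs meeting the blob -/

/-- **Locality of the exploration.** If two configurations agree on every pair meeting the blob of the first, they have the same
contact-free rounds and the same contact-free layers. [this work] -/
theorem layer_eq_of_agree {N : Set V} {o : V} {ω ω' : BondConfig V}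
    (hag : ∀ e : Sym2 V, (∃ u ∈ blob N o ω, u ∈ e) → (e ∈ ω ↔ e ∈ ω')) :
    ∀ t, (ContactFree N o ω t ↔ ContactFree N o ω' t) ∧ (ContactFree N o ω t → layer N o ω t = layer N o ω' t) := by
  intro t
  induction t with
  | zero =>
    refine ⟨?_, fun _ => rfl⟩
    simp only [ContactFree, Nat.le_zero, forall_eq, layer_zero]
  | succ t ih =>
    obtain ⟨ihcf, ihl⟩ := ih
    -- if round `t` is contact-free, the next layers agree
    have hstep : ContactFree N o ω t → layer N o ω (t + 1) = layer N o ω' (t + 1) := by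
      intro hcf
      have hl := ihl hcf
      rw [layer_succ, layer_succ, ← hl]
      congr 1
      ext v
      simp only [mem_setOf_eq]
      constructor
      · rintro ⟨u, hu, huN, hne, huv⟩
        exact ⟨u, hu, huN, hne, (hag _ ⟨u, layer_subset_blob hcf hu, Sym2.mem_mk_left u v⟩).1 huv⟩
      · rintro ⟨u, hu, huN, hne, huv⟩
        exact ⟨u, hu, huN, hne, (hag _ ⟨u, layer_subset_blob hcf hu, Sym2.mem_mk_left u v⟩).2 huv⟩
    refine ⟨?_, fun h => hstep (contactFree_mono (Nat.le_succ t) h)⟩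
    rw [contactFree_succ_iff, contactFree_succ_iff]
    constructor
    · rintro ⟨hcf, hnew⟩
      exact ⟨ihcf.1 hcf, by rw [← hstep hcf]; exact hnew⟩
    · rintro ⟨hcf', hnew⟩
      have hcf := ihcf.2 hcf'
      exact ⟨hcf, by rw [hstep hcf]; exact hnew⟩

/-- Under the agreement of `layer_eq_of_agree`, the blobs coincide. [this work] -/
theorem blob_eq_of_agree {N : Set V} {o : V} {ω ω' : BondConfig V}
    (hag : ∀ e : Sym2 V, (∃ u ∈ blob N o ω, u ∈ e) → (e ∈ ω ↔ e ∈ ω')) :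
    blob N o ω = blob N o ω' := by
  ext v
  constructor
  · rintro ⟨t, hcf, hv⟩
    obtain ⟨hcfiff, hl⟩ := layer_eq_of_agree hag t
    exact ⟨t, hcfiff.1 hcf, by rw [← hl hcf]; exact hv⟩
  · rintro ⟨t, hcf', hv⟩
    obtain ⟨hcfiff, hl⟩ := layer_eq_of_agree hag t
    have hcf := hcfiff.2 hcf'
    exact ⟨t, hcf, by rw [hl hcf]; exact hv⟩

/-- … and so do the contact sets. [this work] -/
theorem contacts_eq_of_agree {N : Set V} {o : V} {ω ω' : BondConfig V}
    (hag : ∀ e : Sym2 V, (∃ u ∈ blob N o ω, u ∈ e) → (e ∈ ω ↔ e ∈ ω')) :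
    contacts N o ω = contacts N o ω' := by
  have hb := blob_eq_of_agree hag
  ext v
  simp only [contacts, mem_setOf_eq, ← hb]
  constructor
  · rintro ⟨hv, u, hu, hne, huv⟩
    exact ⟨hv, u, hu, hne, (hag _ ⟨u, hu, Sym2.mem_mk_left u v⟩).1 huv⟩
  · rintro ⟨hv, u, hu, hne, huv⟩
    exact ⟨hv, u, hu, hne, (hag _ ⟨u, hu, Sym2.mem_mk_left u v⟩).2 huv⟩

/-- **The leaf event `{blob = U, contacts = B}` is determined by the pairs meeting `U`.** [this work] -/
theorem determinedBy_leaf (N : Set V) (o : V) (U B : Set V) :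
    DeterminedBy {ω : BondConfig V | blob N o ω = U ∧ contacts N o ω = B} {e : Sym2 V | ∃ u ∈ U, u ∈ e} := by
  rw [determinedBy_iff]
  -- symmetric statement: prove one direction as a lemma
  have key : ∀ ω ω' : BondConfig V, ω ∩ {e : Sym2 V | ∃ u ∈ U, u ∈ e} = ω' ∩ {e | ∃ u ∈ U, u ∈ e} →
      (blob N o ω = U ∧ contacts N o ω = B) → (blob N o ω' = U ∧ contacts N o ω' = B) := by
    rintro ω ω' hωω' ⟨hU, hB⟩
    have hag : ∀ e : Sym2 V, (∃ u ∈ blob N o ω, u ∈ e) → (e ∈ ω ↔ e ∈ ω') := by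
      intro e he
      rw [hU] at he
      have := Set.ext_iff.1 hωω' e
      simp only [mem_inter_iff, mem_setOf_eq, he, and_true] at this
      exact this
    exact ⟨by rw [← blob_eq_of_agree hag]; exact hU, by rw [← contacts_eq_of_agree hag]; exact hB⟩
  intro ω ω' hωω'
  exact ⟨key ω ω' hωω', key ω' ω hωω'.symm⟩

/-! ### STAR, JOIN and the dead leaves -/

/-- **STAR**: on `{blob = U, contacts = B}` every open pair from `U` to a vertex outside `U` ends in `B`. [this work] -/
theorem star_of_leaf {N : Set V} {o : V} {U B : Set V} {ω : BondConfig V}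
    (h : blob N o ω = U ∧ contacts N o ω = B) :
    ∀ u ∈ U, ∀ x, x ∉ U → s(u, x) ∈ ω → x ∈ B := by
  obtain ⟨hU, hB⟩ := h
  intro u hu x hxU hux
  rw [← hB]
  rw [← hU] at hu hxU
  exact ⟨hxU, u, hu, fun hux' => hxU (hux' ▸ hu), hux⟩

/-- **JOIN**: on `{blob = U, contacts = B}` every contact vertex is attached by an open pair to a blob vertex reached from `o`.
[this work] -/
theorem join_of_leaf {N : Set V} {o : V} {U B : Set V} {ω : BondConfig V}
    (h : blob N o ω = U ∧ contacts N o ω = B) :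
    ∀ x ∈ B, x ∉ U → ∃ u ∈ U, s(u, x) ∈ ω ∧ (openGraph ω).Reachable o u := by
  obtain ⟨hU, hB⟩ := h
  intro x hxB _
  rw [← hB] at hxB
  obtain ⟨_, u, hu, _, hux⟩ := hxB
  exact ⟨u, hU ▸ hu, hux, reachable_of_mem_blob hu⟩

/-- Following an open walk from a layer vertex: either the endpoint is reached by the layers, or a forbidden vertex is.
[this work] -/
theorem walk_layers {N : Set V} {o : V} {ω : BondConfig V} {x y : V} (p : (openGraph ω).Walk x y) :
    ∀ t, x ∈ layer N o ω t → (∃ s, y ∈ layer N o ω s) ∨ (∃ z ∈ N, ∃ s, z ∈ layer N o ω s) := by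
  induction p with
  | nil => exact fun t hx => Or.inl ⟨t, hx⟩
  | cons hadj p ih =>
    rename_i x z y'
    intro t hx
    by_cases hxN : x ∈ N
    · exact Or.inr ⟨x, hxN, t, hx⟩
    · have hxz : s(x, z) ∈ ω ∧ x ≠ z := (openGraph_adj ω x z).1 hadj
      exact ih (t + 1) (Or.inr ⟨x, hx, hxN, hxz.2, hxz.1⟩)

/-- **Dead leaves**: if the contact set contains no forbidden vertex then `o` is joined to no forbidden vertex (`o ∉ N`).
(A first forbidden vertex reached by the layers would be a contact.) [this work] -/
theorem not_reachable_of_contacts_free {N : Set V} {o : V} {ω : BondConfig V} (ho : o ∉ N)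
    (hB : ∀ z ∈ N, z ∉ contacts N o ω) : ∀ z ∈ N, ¬ (openGraph ω).Reachable o z := by
  -- no forbidden vertex is ever reached by the layers
  have hnever : ∀ t, ∀ z ∈ N, z ∉ layer N o ω t := by
    by_contra hcon
    push Not at hcon
    -- first round at which some forbidden vertex is reached
    let P : ℕ → Prop := fun t => ∃ z ∈ N, z ∈ layer N o ω t
    have hP : ∃ t, P t := by
      obtain ⟨t, z, hz, hzt⟩ := hcon
      exact ⟨t, z, hz, hzt⟩
    let t₀ := Nat.find hP
    have ht₀ : P t₀ := Nat.find_spec hP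
    have hmin : ∀ s < t₀, ¬ P s := fun s hs => Nat.find_min hP hs
    obtain ⟨z, hzN, hzt⟩ := ht₀
    -- `t₀ ≠ 0` since `layer 0 = {o}` and `o ∉ N`
    have ht0 : t₀ ≠ 0 := by
      intro h0
      have : z ∈ layer N o ω 0 := h0 ▸ hzt
      rw [layer_zero, mem_singleton_iff] at this
      exact ho (this ▸ hzN)
    obtain ⟨t₁, ht₁⟩ : ∃ t₁, t₀ = t₁ + 1 := Nat.exists_eq_succ_of_ne_zero ht0
    have hcf : ContactFree N o ω t₁ := by
      intro s hs v hv hvN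
      exact hmin s (by rw [ht₁]; exact Nat.lt_succ_of_le hs) ⟨v, hvN, hv⟩
    rw [ht₁, layer_succ] at hzt
    rcases hzt with hzt | ⟨u, hu, _, hne, huz⟩
    · exact hmin t₁ (by rw [ht₁]; exact Nat.lt_succ_self t₁) ⟨z, hzN, hzt⟩
    · -- `z` is a contact
      have hzblob : z ∉ blob N o ω := fun h => blob_subset_compl N o ω h hzN
      exact hB z hzN ⟨hzblob, u, layer_subset_blob hcf hu, hne, huz⟩
  intro z hzN hreach
  obtain ⟨p⟩ := hreach
  rcases walk_layers (N := N) p 0 (by rw [layer_zero]; rfl) with ⟨s, hs⟩ | ⟨z', hz'N, s, hs⟩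
  · exact hnever s z hzN hs
  · exact hnever s z' hz'N hs

end ExploreBFS

end Summit.CriticalPhenomena.PercolationContinuityZ3.Theorems
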